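import Summits.QuantumFields.YangMills.Theorems.UnitScaleTiltProp7SymAvgGLBridge
import Summits.QuantumFields.YangMills.Theorems.UnitScaleTiltProp8IterPlaqSmallAllL
import Literature.MathematicalPhysics.QuantumFieldTheory.Balaban1983to89.T3PrintedRegularMinimiser
import HarnessLib

/-!
# Route `UnitScaleTilt`, crux K1 child «MinimiserStabilityRegPr» (stmt-QuantumFields-19200), skeleton v10 stub EX, route (α), node (AVG-SYM) —
# **THE k-STEP (0.4) LOOP GUARDS FROM THE PRINTED-REGULAR WINDOW, AND THE ROUTE'S DESCENT = THE COMPLEXIFIED DESCENT ON `𝔘_k(ε₀)`**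
# (OWNER ym3-torus-plan g25, 03:08:07Z successor start list item (b): «k-step loop smallness from `RegPr` for `unitsField_toUField_descendTo_of_small`
# (needed by every `descendToGL` consumer) FIRST»)

Cell `ym3-torus` ∕ width seat `ym-ust-19200-w1` (gen 4).  YM₃ on T³ is ladder rung R3, NOT the Clay problem; nothing here is a claim about the stub, the crux,
d = 4 or the mass gap.  `--supports stmt-QuantumFields-19200 --as helper`; count-neutral.

WHY.  The complexified symmetric average `Prop7SymAvgGL.avgFunGL ∕ iterGL ∕ descendToGL` (p599179; = `Prop8Chart.emlIterU` read through `fieldShift`, p600171)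
carries the chart row CHART-47-T³-sym of route (α); its agreement with the ROUTE's average `T3TiltDescent.descendTo F ℰp` (`Averaging.iter (blockAvg ℰp)` ∘ `fieldShift`)
was proved (`Prop7SymAvgGL.unitsField_toUField_descendTo_of_small`) UNDER the hypothesis that every (0.4) loop variable of every lower iterate
`Ū^{(s)} = Averaging.iter (blockAvg ℰp) s U`, `s < K − n`, is within `δ_{SU(2)}` of `1` (the guard of `ExpMeanLog.expMeanLogSU`, on which `ESU = exp ∘ meanLog`).
This file DISCHARGES that hypothesis from the plaquette clause of print's regular space (6)∕(14), `|U(∂p) − 1| < ε₀L^{−2(K−n)}`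
(`T3RegularMinimiser.regThreshold`, the first clause of `T3PrintedRegularMinimiser.RegPr`), under the absolute smallness `10⁷·L³·ε₀ ≤ 1` — by the cell's
k-UNIFORM, EVERY-`L` multi-level plaquette smallness `IterPlaqSmallAllL.plaqSmall_iter_T3_allL` ([Balaban1985Variational] (146): the `s`-fold average is
`(10800L+1)·ε₀L^{2s−2(K−n)}`-small) and the Stokes half `LatticeWordStokes.small_of_plaqSmall` (a loop of (0.4) spans `≤ ((d+2)L)²∕4` plaquettes), with the
budget `(25L²∕4)(10800L+1)ε₀ ≤ 1∕50 < δ_{SU(2)}` (the one pillar P0 uses).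

WHAT IS PROVED (sorry-free, no definition).
* `guard_budget_T3` — the arithmetic: `(((d+2)L)²∕4)·(10800L+1)·L^{2s}·ε₀L^{−2(K−n)} < δ_{SU(2)}` for `s ≤ K − n`, `10⁷L³ε₀ ≤ 1`.
* ★ `small_iter_of_plaqSmall_T3` ∕ `loopSmall_iter_of_plaqSmall_T3` ∕ `…_of_regPr` — **for EVERY `s ≤ K − n` and every coarse bond `c`, `BlockAveraging.Small ℰp (Ū^{(s)}) c`**,
  i.e. `‖Ū^{(s)}(loop_i(c)) − 1‖ < δ_{SU(2)}` for every loop index `i`: the guards of ALL the route's averaging steps are inactive on `𝔘_k(ε₀)` (k-uniform, every `L`).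
* ★★ `unitsField_toUField_iter_of_regPr` ∕ **`unitsField_toUField_descendTo_of_regPr`** (and `_of_plaqSmall_T3` forms) — on `𝔘_k(ε₀)` with `10⁷L³ε₀ ≤ 1`:
  `(Ū^{(k)})♭ = iterGL k (U♭)` for `k ≤ K − n` and **`(D_{n,K} U)♭ = descendToGL F n K h (U♭)`** (`♭ = unitsField ∘ toUField : SU(2) → (M₂)ˣ`); `emlIterU` readings
  `coe_iter_eq_emlIterU_of_regPr` ∕ `descendTo_eq_fieldShift_emlIterU_of_regPr` through p600171.
* ★ `descendToGL_eq_of_mem_fibre_of_regPr` ∕ `descendToGL_eq_of_mem_regFibrePr` — THE AVERAGING CONSTRAINT (3) IN `(M₂)ˣ` LETTERS: for `U ∈ 𝔅_k(V)` printed-regular,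
  `descendToGL (U♭) = V♭`; hence ★ `logChartSym_eq_zero_of_mem_fibre` — **the route's regular fibre through `V` lies in the ZERO SET of the complexified log-chart
  `logChartSym U₀` at any printed-regular background `U₀` of the same fibre** (the fibre clause of CHART-5∕(112) in the ROUTE's letters, forward direction).
HONEST SCOPE.  Compositions of landed theorems + one budget; no new estimate.  NOT here: the converse inclusion (zero set ∩ `SU(2)`-valued ⊆ fibre needs `‖D(U)(c)V(c)⁻¹ − 1‖ < 1`,
i.e. (14)'s `CloseAvg` — a two-field statement), complex perturbations `e^{A}U₀♭` (★w4-20520's `Prop7SymAvgRelativeBound*`, `emlIterU` letters), the divergence clause (idle here).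

References: T. Bałaban, CMP **102** (1985) 277–309 [Balaban1985Variational] ((2), (3), (6) p.278, (14) p.280, (44) p.285, (146) p.301); CMP **109** (1987) 249–301
[Balaban1987RG1] ((0.4)–(0.11) p.253); CMP **98** (1985) 17–51 [Balaban1985Averaging] (Prop. 4 (134)–(135) p.38); CMP **99** (1985) 75–102 [Balaban1985RegularSpaces] ((1.7) p.77).
-/

noncomputable section

open scoped Matrix.Norms.L2Operator

namespace Summit.QuantumFields.YangMills.Theorems.Prop7SymAvgGLSmallOfRegPr

open NormedSpace
open Literature.MathematicalPhysics.QuantumFieldTheory.Balaban1983to89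
open T3ContinuumYM3Torus
open T4Continuum BlockAveraging
open ExpMeanLog (expMeanLogSU deltaSU expMeanLogSU_δ)
open T3RegularMinimiser (regThreshold)
open T3PrintedRegularMinimiser (RegPr regFibrePr mem_regFibrePr_iff)
open T3ConstrainedMinimiser (fibre)
open T3TiltDescent (descendTo)
open T3LevelShift (fieldShift)
open T3SectALandauChart (bgUnits)
open B7Prop1Explicit (expUnit)
open B10Eq27TorusAxialLog (unitsField toUField)
open MatrixLog (mlog mlog_one)
open Summit.QuantumFields.YangMills.Theorems.IterPlaqSmall (one_div_fifty_lt_deltaSU_fin_two)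
open Summit.QuantumFields.YangMills.Theorems.IterPlaqSmallAllL (plaqSmall_iter_T3_allL)
open Summit.QuantumFields.YangMills.Theorems.Prop8Chart (emlIterU)
open Summit.QuantumFields.YangMills.Theorems.Prop7SymAvgGL (iterGL descendToGL logChartSym unitsField_toUField_iter_of_small unitsField_toUField_descendTo_of_small
  iterGL_eq_emlIterU descendToGL_eq_fieldShift_emlIterU)

/-! ## §1 The budget -/

/-- **THE GUARD BUDGET AT THE d = 3 CARRIER**: for `s ≤ K − n` and `10⁷·L³·ε₀ ≤ 1`,
`(((d+2)L)²∕4)·((10800L+1)·(L^{2s}·ε₀L^{−2(K−n)})) < δ_{SU(2)}` (`L^{2s}·ε₀L^{−2(K−n)} ≤ ε₀`, `(25L²∕4)(10800L+1)ε₀ ≤ 67507·L³ε₀ ≤ 1∕50 < δ₂`).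
[cite: Balaban1985Variational, (146) p.301] -/
theorem guard_budget_T3 (F : T3Family) (n K : ℕ) {ε₀ : ℝ} (hε₀ : 0 < ε₀) (hε : 10 ^ 7 * (F.L : ℝ) ^ 3 * ε₀ ≤ 1) {s : ℕ} (hs : s ≤ K - n) :
    ((((F.P K).d + 2) * (F.P K).L : ℕ) : ℝ) ^ 2 / 4 * ((10800 * (F.L : ℝ) + 1) * ((F.L : ℝ) ^ (2 * s) * regThreshold F n K ε₀)) < deltaSU (Fin 2) := by
  have hd : (F.P K).d = 3 := T3Family.P_d F K
  have hLL : ((F.P K).L : ℝ) = F.L := rfl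
  have hL3 : 3 ≤ F.L := by obtain ⟨a, ha⟩ := F.hL.1; have := F.hL.2; omega
  have hL3r : (3 : ℝ) ≤ F.L := by exact_mod_cast hL3
  have hL0 : (0 : ℝ) < F.L := by linarith
  -- `L^{2s}·ε₀L^{−2(K−n)} ≤ ε₀`
  set X : ℝ := (F.L : ℝ) ^ (2 * s) * regThreshold F n K ε₀ with hX
  have hX0 : 0 ≤ X := by rw [hX]; unfold regThreshold; positivity
  have hXε : X ≤ ε₀ := by
    rw [hX]
    unfold regThreshold
    have hle : (F.L : ℝ) ^ (2 * s) ≤ (F.L : ℝ) ^ (2 * (K - n)) := pow_le_pow_right₀ (by linarith) (by omega)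
    have hpos : (0 : ℝ) < (F.L : ℝ) ^ (2 * (K - n)) := by positivity
    rw [inv_pow, show (F.L : ℝ) ^ (2 * s) * (ε₀ * ((F.L : ℝ) ^ (2 * (K - n)))⁻¹) = ε₀ * ((F.L : ℝ) ^ (2 * s) / (F.L : ℝ) ^ (2 * (K - n))) by ring]
    calc ε₀ * ((F.L : ℝ) ^ (2 * s) / (F.L : ℝ) ^ (2 * (K - n))) ≤ ε₀ * 1 :=
          mul_le_mul_of_nonneg_left ((div_le_one hpos).2 hle) hε₀.le
      _ = ε₀ := mul_one _
  refine lt_of_le_of_lt ?_ one_div_fifty_lt_deltaSU_fin_two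
  rw [hd]
  push_cast
  rw [hLL]
  -- `(5L)²∕4 · (10800L+1) · X ≤ (25∕4)·10801·L³ε₀ ≤ 1∕50`
  have h1 : (F.L : ℝ) ^ 2 * (10800 * (F.L : ℝ) + 1) * X ≤ (F.L : ℝ) ^ 2 * (10800 * (F.L : ℝ) + 1) * ε₀ :=
    mul_le_mul_of_nonneg_left hXε (by positivity)
  have h2 : (F.L : ℝ) ^ 2 * ε₀ ≤ (F.L : ℝ) ^ 3 * ε₀ :=
    mul_le_mul_of_nonneg_right (pow_le_pow_right₀ (by linarith) (by norm_num)) hε₀.le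
  nlinarith [h1, h2, hX0, mul_nonneg (sq_nonneg (F.L : ℝ)) hX0]

/-- `ℰp`'s guard radius is `δ_{SU(2)}` (bookkeeping, `rfl`). [cite: Balaban1987RG1, (0.4) p.253] -/
theorem ℰp_δ : (T3UnitLawDensityEML.ℰp).δ = deltaSU (Fin 2) := rfl

/-! ## §2 The k-step loop guards on `𝔘_k(ε₀)` -/

/-- ★ **THE (0.4) LOOP GUARDS OF EVERY AVERAGING STEP HOLD ON THE PRINTED-REGULAR PLAQUETTE WINDOW** (k-uniform, every block size `L`): if every plaquette variable of
`U : GaugeField (F.P K) 0 SU(2)` is within `ε₀L^{−2(K−n)}` of `1`, `0 < ε₀`, `10⁷L³ε₀ ≤ 1`, then for every `s ≤ K − n` and every coarse bond `c` of level `s + 1`,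
`BlockAveraging.Small ℰp (Ū^{(s)}) c` — every loop variable `Ū^{(s)}(Γ ∪ [x,x′] ∪ (−Γ′) ∪ (−c))` of the `s`-fold ROUTE average is within `δ_{SU(2)}` of `1`.
[cite: Balaban1985Variational, (146) p.301; Balaban1987RG1, (0.4) p.253] -/
theorem small_iter_of_plaqSmall_T3 (F : T3Family) (n K : ℕ) {ε₀ : ℝ} (hε₀ : 0 < ε₀) (hε : 10 ^ 7 * (F.L : ℝ) ^ 3 * ε₀ ≤ 1)
    (U : GaugeField (F.P K) 0 (Matrix.specialUnitaryGroup (Fin 2) ℂ)) (hU : PlaqSmall (regThreshold F n K ε₀) U) :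
    ∀ s, s ≤ K - n → ∀ c : PBond (F.P K) (s + 1),
      Small T3UnitLawDensityEML.ℰp (Averaging.iter (fun l => blockAvg (P := F.P K) (j := l) T3UnitLawDensityEML.ℰp) s U) c := by
  intro s hs c
  have hpl := plaqSmall_iter_T3_allL F n K hε₀ hε U hU s hs
  have hL0 : (0 : ℝ) ≤ (F.L : ℝ) := Nat.cast_nonneg _
  have ht0 : 0 ≤ (10800 * (F.L : ℝ) + 1) * ((F.L : ℝ) ^ (2 * s) * regThreshold F n K ε₀) := by
    unfold regThreshold; positivity
  refine LatticeWordStokes.small_of_plaqSmall T3UnitLawDensityEML.ℰp ht0 hpl ?_ c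
  rw [ℰp_δ]
  exact guard_budget_T3 F n K hε₀ hε hs

/-- ★ The same in the `(M₂)`-norm letters of `Prop7SymAvgGL.unitsField_toUField_descendTo_of_small`: for every `s ≤ K − n`, coarse bond `c` and loop index `i`,
`‖Ū^{(s)}(loop_i(c)) − 1‖ < δ_{SU(2)}`. [cite: Balaban1985Variational, (146) p.301; Balaban1987RG1, (0.4) p.253] -/
theorem loopSmall_iter_of_plaqSmall_T3 (F : T3Family) (n K : ℕ) {ε₀ : ℝ} (hε₀ : 0 < ε₀) (hε : 10 ^ 7 * (F.L : ℝ) ^ 3 * ε₀ ≤ 1)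
    (U : GaugeField (F.P K) 0 (Matrix.specialUnitaryGroup (Fin 2) ℂ)) (hU : PlaqSmall (regThreshold F n K ε₀) U) :
    ∀ s, s ≤ K - n → ∀ (c : PBond (F.P K) (s + 1)) (i : Idx (F.P K)),
      ‖((loopHol (Averaging.iter (fun l => blockAvg (P := F.P K) (j := l) T3UnitLawDensityEML.ℰp) s U) c i : Matrix.specialUnitaryGroup (Fin 2) ℂ) :
          Matrix (Fin 2) (Fin 2) ℂ) - 1‖ < deltaSU (Fin 2) :=
  fun s hs c i => small_iter_of_plaqSmall_T3 F n K hε₀ hε U hU s hs c i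

/-- ★ **ON PRINT'S REGULAR SPACE `𝔘_k(ε₀)` (`RegPr`, both clauses; only the plaquette clause is used)**: the loop guards of every averaging step, `s ≤ K − n`.
[cite: Balaban1985Variational, (2) p.278, (146) p.301] -/
theorem small_iter_of_regPr (F : T3Family) (n K : ℕ) {ε₀ : ℝ} (hε₀ : 0 < ε₀) (hε : 10 ^ 7 * (F.L : ℝ) ^ 3 * ε₀ ≤ 1)
    {U : GaugeField (F.P K) 0 (Matrix.specialUnitaryGroup (Fin 2) ℂ)} (hU : RegPr F n K ε₀ U) :
    ∀ s, s ≤ K - n → ∀ c : PBond (F.P K) (s + 1),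
      Small T3UnitLawDensityEML.ℰp (Averaging.iter (fun l => blockAvg (P := F.P K) (j := l) T3UnitLawDensityEML.ℰp) s U) c :=
  small_iter_of_plaqSmall_T3 F n K hε₀ hε U hU.plaqSmall

/-- ★ The norm form on `𝔘_k(ε₀)`. [cite: Balaban1985Variational, (2) p.278, (146) p.301] -/
theorem loopSmall_iter_of_regPr (F : T3Family) (n K : ℕ) {ε₀ : ℝ} (hε₀ : 0 < ε₀) (hε : 10 ^ 7 * (F.L : ℝ) ^ 3 * ε₀ ≤ 1)
    {U : GaugeField (F.P K) 0 (Matrix.specialUnitaryGroup (Fin 2) ℂ)} (hU : RegPr F n K ε₀ U) :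
    ∀ s, s ≤ K - n → ∀ (c : PBond (F.P K) (s + 1)) (i : Idx (F.P K)),
      ‖((loopHol (Averaging.iter (fun l => blockAvg (P := F.P K) (j := l) T3UnitLawDensityEML.ℰp) s U) c i : Matrix.specialUnitaryGroup (Fin 2) ℂ) :
          Matrix (Fin 2) (Fin 2) ℂ) - 1‖ < deltaSU (Fin 2) :=
  loopSmall_iter_of_plaqSmall_T3 F n K hε₀ hε U hU.plaqSmall

/-! ## §3 The route's iterate and descent ARE the complexified ones on `𝔘_k(ε₀)` -/

/-- ★★ **`k` STEPS OF THE ROUTE'S AVERAGE = `iterGL k` ON THE PLAQUETTE WINDOW**, `k ≤ K − n`: `(Ū^{(k)})♭ = iterGL k (U♭)`.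
[cite: Balaban1987RG1, (0.4)+(0.11) p.253; Balaban1985Variational, (146) p.301] -/
theorem unitsField_toUField_iter_of_plaqSmall_T3 (F : T3Family) (n K : ℕ) {ε₀ : ℝ} (hε₀ : 0 < ε₀) (hε : 10 ^ 7 * (F.L : ℝ) ^ 3 * ε₀ ≤ 1)
    (U : GaugeField (F.P K) 0 (Matrix.specialUnitaryGroup (Fin 2) ℂ)) (hU : PlaqSmall (regThreshold F n K ε₀) U) {k : ℕ} (hk : k ≤ K - n) :
    unitsField (toUField (Averaging.iter (fun l => blockAvg (P := F.P K) (j := l) T3UnitLawDensityEML.ℰp) k U)) = iterGL k (unitsField (toUField U)) :=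
  unitsField_toUField_iter_of_small U k fun s hs c i => loopSmall_iter_of_plaqSmall_T3 F n K hε₀ hε U hU s (hs.le.trans hk) c i

/-- ★★ The same on `𝔘_k(ε₀)`. [cite: Balaban1987RG1, (0.4)+(0.11) p.253; Balaban1985Variational, (2) p.278] -/
theorem unitsField_toUField_iter_of_regPr (F : T3Family) (n K : ℕ) {ε₀ : ℝ} (hε₀ : 0 < ε₀) (hε : 10 ^ 7 * (F.L : ℝ) ^ 3 * ε₀ ≤ 1)
    {U : GaugeField (F.P K) 0 (Matrix.specialUnitaryGroup (Fin 2) ℂ)} (hU : RegPr F n K ε₀ U) {k : ℕ} (hk : k ≤ K - n) :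
    unitsField (toUField (Averaging.iter (fun l => blockAvg (P := F.P K) (j := l) T3UnitLawDensityEML.ℰp) k U)) = iterGL k (unitsField (toUField U)) :=
  unitsField_toUField_iter_of_plaqSmall_T3 F n K hε₀ hε U hU.plaqSmall hk

/-- ★★★ **THE ROUTE'S DESCENT IS THE COMPLEXIFIED DESCENT ON THE PLAQUETTE WINDOW**: `(D_{n,K} U)♭ = descendToGL F n K h (U♭)` for every `U` with
`|U(∂p) − 1| < ε₀L^{−2(K−n)}`, `10⁷L³ε₀ ≤ 1` — the hypothesis `hsmall` of `Prop7SymAvgGL.unitsField_toUField_descendTo_of_small` DISCHARGED.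
[cite: Balaban1987RG1, (0.4) p.253; Balaban1985UV3, (1)–(3) p.256; Balaban1985Variational, (146) p.301] -/
theorem unitsField_toUField_descendTo_of_plaqSmall_T3 (F : T3Family) {n K : ℕ} (h : n ≤ K) {ε₀ : ℝ} (hε₀ : 0 < ε₀) (hε : 10 ^ 7 * (F.L : ℝ) ^ 3 * ε₀ ≤ 1)
    (U : GaugeField (F.P K) 0 (Matrix.specialUnitaryGroup (Fin 2) ℂ)) (hU : PlaqSmall (regThreshold F n K ε₀) U) :
    unitsField (toUField (descendTo F T3UnitLawDensityEML.ℰp n K h U)) = descendToGL F n K h (unitsField (toUField U)) :=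
  unitsField_toUField_descendTo_of_small F h U fun s hs c i => loopSmall_iter_of_plaqSmall_T3 F n K hε₀ hε U hU s hs.le c i

/-- ★★★ **THE ROUTE'S DESCENT IS THE COMPLEXIFIED DESCENT ON `𝔘_k(ε₀)`** (`RegPr F n K ε₀ U`, `10⁷L³ε₀ ≤ 1`): `(D_{n,K} U)♭ = descendToGL F n K h (U♭)` — every
`descendToGL` consumer's smallness hypothesis, by name, from print's regular space. [cite: Balaban1987RG1, (0.4) p.253; Balaban1985Variational, (2) p.278, (6) p.278] -/
theorem unitsField_toUField_descendTo_of_regPr (F : T3Family) {n K : ℕ} (h : n ≤ K) {ε₀ : ℝ} (hε₀ : 0 < ε₀) (hε : 10 ^ 7 * (F.L : ℝ) ^ 3 * ε₀ ≤ 1)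
    {U : GaugeField (F.P K) 0 (Matrix.specialUnitaryGroup (Fin 2) ℂ)} (hU : RegPr F n K ε₀ U) :
    unitsField (toUField (descendTo F T3UnitLawDensityEML.ℰp n K h U)) = descendToGL F n K h (unitsField (toUField U)) :=
  unitsField_toUField_descendTo_of_plaqSmall_T3 F h hε₀ hε U hU.plaqSmall

/-- The `emlIterU` reading (p600171 `iterGL_eq_emlIterU`): on `𝔘_k(ε₀)`, `(Ū^{(k)})♭ = emlIterU k (U♭)`, `k ≤ K − n` — the UNGUARDED units-field average of
`Prop8Chart` IS the route's, read in `(M₂)ˣ`. [cite: Balaban1987RG1, (0.11) p.253; Balaban1985Variational, (2) p.278] -/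
theorem coe_iter_eq_emlIterU_of_regPr (F : T3Family) (n K : ℕ) {ε₀ : ℝ} (hε₀ : 0 < ε₀) (hε : 10 ^ 7 * (F.L : ℝ) ^ 3 * ε₀ ≤ 1)
    {U : GaugeField (F.P K) 0 (Matrix.specialUnitaryGroup (Fin 2) ℂ)} (hU : RegPr F n K ε₀ U) {k : ℕ} (hk : k ≤ K - n) :
    unitsField (toUField (Averaging.iter (fun l => blockAvg (P := F.P K) (j := l) T3UnitLawDensityEML.ℰp) k U)) = emlIterU k (unitsField (toUField U)) := by
  rw [unitsField_toUField_iter_of_regPr F n K hε₀ hε hU hk, iterGL_eq_emlIterU]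

/-- The `emlIterU` reading of the descent (p600171 `descendToGL_eq_fieldShift_emlIterU`): on `𝔘_k(ε₀)`, `(D_{n,K} U)♭ = fieldShift h_{n,K} (emlIterU (K − n) (U♭))`.
[cite: Balaban1987RG1, (0.4) p.253; Balaban1985UV3, (1)–(3) p.256] -/
theorem descendTo_eq_fieldShift_emlIterU_of_regPr (F : T3Family) {n K : ℕ} (h : n ≤ K) {ε₀ : ℝ} (hε₀ : 0 < ε₀) (hε : 10 ^ 7 * (F.L : ℝ) ^ 3 * ε₀ ≤ 1)
    {U : GaugeField (F.P K) 0 (Matrix.specialUnitaryGroup (Fin 2) ℂ)} (hU : RegPr F n K ε₀ U) :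
    unitsField (toUField (descendTo F T3UnitLawDensityEML.ℰp n K h U)) =
      fieldShift (F.sitesPerDir_eq (m := F.m) (K := n) (j := 0) (m' := F.m) (K' := K) (j' := K - n) (by omega)) (emlIterU (K - n) (unitsField (toUField U))) := by
  rw [unitsField_toUField_descendTo_of_regPr F h hε₀ hε hU, descendToGL_eq_fieldShift_emlIterU]

/-! ## §4 The averaging constraint in `(M₂)ˣ` letters; the fibre lies in the zero set of the log-chart -/

/-- ★ **THE CONSTRAINT (3) IN `(M₂)ˣ` LETTERS**: for `U ∈ 𝔅_k(V)` (`T3ConstrainedMinimiser.fibre`: `D_{n,K} U = V`) printed-regular with `10⁷L³ε₀ ≤ 1`,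
`descendToGL F n K h (U♭) = V♭`. [cite: Balaban1985Variational, (3) p.278, (6) p.278] -/
theorem descendToGL_eq_of_mem_fibre_of_regPr (F : T3Family) {n K : ℕ} (h : n ≤ K) {ε₀ : ℝ} (hε₀ : 0 < ε₀) (hε : 10 ^ 7 * (F.L : ℝ) ^ 3 * ε₀ ≤ 1)
    {V : GaugeField (F.P n) 0 (Matrix.specialUnitaryGroup (Fin 2) ℂ)} {U : GaugeField (F.P K) 0 (Matrix.specialUnitaryGroup (Fin 2) ℂ)}
    (hUV : U ∈ fibre F T3UnitLawDensityEML.ℰp n K h V) (hU : RegPr F n K ε₀ U) :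
    descendToGL F n K h (unitsField (toUField U)) = unitsField (toUField V) := by
  have hUV' : descendTo F T3UnitLawDensityEML.ℰp n K h U = V := hUV
  rw [← unitsField_toUField_descendTo_of_regPr F h hε₀ hε hU, hUV']

/-- ★ The same for PRINT'S REGULAR FIBRE (6) `𝔘_k(ε₀) ∩ 𝔅_k(V)` (`T3PrintedRegularMinimiser.regFibrePr`): `descendToGL (U♭) = V♭` for every `U` in it, `10⁷L³ε₀ ≤ 1`.
[cite: Balaban1985Variational, (6) p.278] -/
theorem descendToGL_eq_of_mem_regFibrePr (F : T3Family) {n K : ℕ} (h : n ≤ K) {ε₀ : ℝ} (hε₀ : 0 < ε₀) (hε : 10 ^ 7 * (F.L : ℝ) ^ 3 * ε₀ ≤ 1)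
    {V : GaugeField (F.P n) 0 (Matrix.specialUnitaryGroup (Fin 2) ℂ)} {U : GaugeField (F.P K) 0 (Matrix.specialUnitaryGroup (Fin 2) ℂ)}
    (hU : U ∈ regFibrePr F n K h ε₀ V) :
    descendToGL F n K h (unitsField (toUField U)) = unitsField (toUField V) :=
  descendToGL_eq_of_mem_fibre_of_regPr F h hε₀ hε ((mem_regFibrePr_iff F).1 hU).1 ((mem_regFibrePr_iff F).1 hU).2

/-- `bgUnits F K U₀ = U₀♭` (the letter of `T3SectALandauChart`, `rfl`). [cite: Balaban1985Averaging, (19) p.21] -/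
theorem bgUnits_eq (F : T3Family) (K : ℕ) (U₀ : GaugeField (F.P K) 0 (Matrix.specialUnitaryGroup (Fin 2) ℂ)) :
    bgUnits F K U₀ = unitsField (toUField U₀) := rfl

/-- ★ **THE ROUTE'S REGULAR FIBRE LIES IN THE ZERO SET OF THE COMPLEXIFIED LOG-CHART** (the fibre clause of CHART-5∕(112) in the route's letters, forward half):
let `U₀, U ∈ 𝔅_k(V)` be printed-regular (`RegPr F n K ε₀ U₀`, `RegPr F n K ε U`, `10⁷L³·max(ε₀, ε) ≤ 1`) and let `A : bonds → M₂(ℂ)` chart `U` over `U₀`,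
`e^{A(b)}·U₀(b) = U(b)` in `(M₂)ˣ`; then `logChartSym F n K h U₀ A = 0` (`D̄(e^{A}U₀♭) = D̄(U♭) = V♭ = D̄(U₀♭)`, `V♭·(V♭)⁻¹ = 1`, `log 1 = 0`).
[cite: Balaban1985Variational, (44) p.285, (112) p.295, (6) p.278] -/
theorem logChartSym_eq_zero_of_mem_fibre (F : T3Family) {n K : ℕ} (h : n ≤ K) {ε₀ ε : ℝ} (hε₀ : 0 < ε₀) (hε₀' : 10 ^ 7 * (F.L : ℝ) ^ 3 * ε₀ ≤ 1)
    (hε : 0 < ε) (hε' : 10 ^ 7 * (F.L : ℝ) ^ 3 * ε ≤ 1)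
    {V : GaugeField (F.P n) 0 (Matrix.specialUnitaryGroup (Fin 2) ℂ)} {U₀ U : GaugeField (F.P K) 0 (Matrix.specialUnitaryGroup (Fin 2) ℂ)}
    (hU₀V : U₀ ∈ fibre F T3UnitLawDensityEML.ℰp n K h V) (hU₀ : RegPr F n K ε₀ U₀)
    (hUV : U ∈ fibre F T3UnitLawDensityEML.ℰp n K h V) (hU : RegPr F n K ε U)
    {A : PBond (F.P K) 0 → Matrix (Fin 2) (Fin 2) ℂ} (hA : (fun b => expUnit (A b) * bgUnits F K U₀ b) = unitsField (toUField U)) :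
    logChartSym F n K h U₀ A = 0 := by
  funext c
  show mlog (_ * _) = 0
  rw [hA, bgUnits_eq, descendToGL_eq_of_mem_fibre_of_regPr F h hε hε' hUV hU, descendToGL_eq_of_mem_fibre_of_regPr F h hε₀ hε₀' hU₀V hU₀,
    Units.mul_inv, mlog_one]

end Summit.QuantumFields.YangMills.Theorems.Prop7SymAvgGLSmallOfRegPr

end
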